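import Summits.ABC.StewartYu.PadicG3ExpClassPM
import HarnessLib

/-!
# Cell abc-stewartyu, crux `Y07Odd` (stmt-ABC-19658), line `gen3-slab-odd`: the RE-BASED HALVED exponents `wᵢ = (vᵢ − v_{i₀})/2` of the next level —
# box, sign classes, slab depth, and the arithmetic of the root exponents relative to the pivot

`Summits/ABC/StewartYu/PadicG3HalfRebase.lean` — cell `abc-stewartyu` (design HOME/p2/HALFSTEP-ODD.md §LEVEL INVARIANT; seat p2-g4, F-odd lead).
Definitions (`halfDiff`, `sgnOf`) and theorems on `G3Setup`; no named fact.  After the Kummer half-step at level `s` the surviving indices form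
the class `B″ = {i : vᵢ ≡ v_{i₀} (mod 2), sgnᵢ = sgn_{i₀}}` of a pivot `i₀` (non-zero coefficient); the next level's exponents are
`wᵢ := (vᵢ − v_{i₀})/2` (`halfDiff`):

* `two_smul_halfDiff` (`vᵢ = v_{i₀} + 2wᵢ`), `abs_halfDiff_le` (box `⌊L/2⌋` from `|vᵢ − v_{i₀}| ≤ L`), `zγ_halfDiff` (`zγ(vᵢ) = zγ(v_{i₀}) + 2zγ(wᵢ)`);
* `cls_halfDiff_sq` (`cls(wᵢ)² = 1` on one sign class), `sgnOf`/`cls_eq_sgnOf` (the new signs `±1`);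
* `norm_Lsum_halfDiff_le`, `norm_E_halfDiff_le` (slab depth is inherited: `2` is a `p`-adic unit), `norm_Lsum_halfDiff_sub_le`;
* `qEhG_rootExp_of_shift` — `qEhG α (rootExp L vᵢ s) = (∏ⱼ αⱼ^{wᵢⱼ s}) · ∏ⱼ αⱼ^{L_j|s| + ⌊v_{i₀ j} s/2⌋}` (general shift, cf. `qEhG_rootExp_of_class`).

WHAT THIS IS NOT: the half-step on the invariant itself (`PadicG3LevelStepH`); no crux moves.

References: Yu. V. Nesterenko, LNM 1819 (2003) §4.3; K. Yu, Compositio 74 (1990) (2.101)–(2.106).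
-/

noncomputable section

open NormedSpace Finset Polynomial
open Literature.NumberTheory.Transcendental
open scoped Nat

namespace Summit.ABC.StewartYu

namespace G3Setup

variable {p : ℕ} [Fact p.Prime] (S : G3Setup p) {ι : Type*} (v : ι → Fin S.n → ℤ) (i₀ : ι)

/-! ### The re-based halved exponents -/

/-- `wᵢ := (vᵢ − v_{i₀})/2`. [cite: Nesterenko2003, §4.3] -/
def halfDiff (i : ι) : Fin S.n → ℤ := fun j => (v i j - v i₀ j) / 2

/-- On the parity class of `i₀`: `vᵢ = v_{i₀} + 2·wᵢ`. [folklore] -/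
theorem eq_add_two_smul_halfDiff {i : ι} (hpar : ∀ j, 2 ∣ v i j - v i₀ j) :
    v i = v i₀ + (2 : ℤ) • S.halfDiff v i₀ i := by
  funext j
  simp only [halfDiff, Pi.add_apply, Pi.smul_apply, smul_eq_mul]
  rw [Int.mul_ediv_cancel' (hpar j)]
  ring

/-- The pivot's own halved exponent is `0`. [folklore] -/
theorem halfDiff_self : S.halfDiff v i₀ i₀ = 0 := by
  funext j; simp [halfDiff]

/-- **The box halves**: `|vᵢⱼ − v_{i₀ⱼ}| ≤ L_j` ⇒ `|wᵢⱼ| ≤ ⌊L_j/2⌋`. [cite: Nesterenko2003, §4.3] -/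
theorem abs_halfDiff_le {i : ι} (hpar : ∀ j, 2 ∣ v i j - v i₀ j) {L : Fin S.n → ℕ} (hL : ∀ j, |v i j - v i₀ j| ≤ (L j : ℤ))
    (j : Fin S.n) : |S.halfDiff v i₀ i j| ≤ ((L j / 2 : ℕ) : ℤ) := by
  obtain ⟨c, hc⟩ := hpar j
  have hw : S.halfDiff v i₀ i j = c := by
    simp only [halfDiff]; rw [hc, Int.mul_ediv_cancel_left _ two_ne_zero]
  rw [hw]
  have h1 := hL j
  rw [hc, abs_le] at h1
  rw [abs_le]
  push_cast
  constructor <;> omega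

/-- `zγ(vᵢ)_k = zγ(v_{i₀})_k + 2·zγ(wᵢ)_k` on the parity class. [folklore] -/
theorem zγ_halfDiff {i : ι} (hpar : ∀ j, 2 ∣ v i j - v i₀ j) (k : Fin S.n) :
    S.zγ (v i) k = S.zγ (v i₀) k + 2 * S.zγ (S.halfDiff v i₀ i) k :=
  S.zγ_reindex (v i₀) (v i) (S.halfDiff v i₀ i) (S.eq_add_two_smul_halfDiff v i₀ hpar) k

/-! ### Sign classes of the new exponents -/

/-- `cls(v_{i₀} + 2w) = cls(v_{i₀}) · cls(w)²`. [folklore] -/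
theorem cls_add_two_smul (u w : Fin S.n → ℤ) : S.cls (u + (2 : ℤ) • w) = S.cls u * S.cls w ^ 2 := by
  unfold cls
  rw [← prod_pow, ← prod_mul_distrib]
  refine prod_congr rfl fun j _ => ?_
  simp only [Pi.add_apply, Pi.smul_apply, smul_eq_mul]
  rw [zpow_add₀ (S.η_ne j), zpow_mul']
  norm_cast

/-- **On one sign class the new exponents have `cls(wᵢ)² = 1`.** [cite: Yu1990, (2.105); shape only] -/
theorem cls_halfDiff_sq {i : ι} (hpar : ∀ j, 2 ∣ v i j - v i₀ j) {sg : ℚ_[p]} (hsg : sg ≠ 0)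
    (hi : S.cls (v i) = sg) (hi₀ : S.cls (v i₀) = sg) : S.cls (S.halfDiff v i₀ i) ^ 2 = 1 := by
  have h := S.cls_add_two_smul (v i₀) (S.halfDiff v i₀ i)
  rw [← S.eq_add_two_smul_halfDiff v i₀ hpar, hi, hi₀] at h
  have : sg * (S.cls (S.halfDiff v i₀ i) ^ 2 - 1) = 0 := by rw [mul_sub, mul_one, ← h, sub_self]
  rcases mul_eq_zero.mp this with h0 | h0
  · exact absurd h0 hsg
  · exact sub_eq_zero.mp h0

/-- The new sign of an index: `+1` if `cls(wᵢ) = 1`, else `−1`. [folklore] -/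
def sgnOf (w : ι → Fin S.n → ℤ) (i : ι) : ℤ := by
  classical
  exact if S.cls (w i) = 1 then 1 else -1

/-- `sgnOf i = ±1`. [folklore] -/
theorem sgnOf_pm (w : ι → Fin S.n → ℤ) (i : ι) : S.sgnOf w i = 1 ∨ S.sgnOf w i = -1 := by
  unfold sgnOf; split_ifs <;> simp

/-- If `cls(wᵢ)² = 1` then `cls(wᵢ) = sgnOf i`. [folklore] -/
theorem cls_eq_sgnOf (w : ι → Fin S.n → ℤ) (i : ι) (hsq : S.cls (w i) ^ 2 = 1) : S.cls (w i) = (S.sgnOf w i : ℚ_[p]) := by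
  unfold sgnOf
  have h2 : S.cls (w i) * S.cls (w i) = 1 := by rw [← pow_two]; exact hsq
  rcases mul_self_eq_one_iff.mp h2 with h | h
  · rw [if_pos h, h]; norm_num
  · have hne : S.cls (w i) ≠ 1 := by rw [h]; norm_num
    rw [if_neg hne, h]; norm_num

/-! ### Slab depth is inherited -/

/-- `Lsum(v_{i₀} + 2w) = Lsum(v_{i₀}) + 2·Lsum(w)`, i.e. `2·Lsum(wᵢ) = Lsum(vᵢ) − Lsum(v_{i₀})`. [folklore] -/
theorem two_mul_Lsum_halfDiff {i : ι} (hpar : ∀ j, 2 ∣ v i j - v i₀ j) :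
    2 * S.Lsum (S.halfDiff v i₀ i) = S.Lsum (v i) - S.Lsum (v i₀) := by
  have h := S.eq_add_two_smul_halfDiff v i₀ hpar (i := i)
  have hL : S.Lsum (v i) = S.Lsum (v i₀ + (2 : ℤ) • S.halfDiff v i₀ i) := by rw [← h]
  rw [hL, S.Lsum_add, S.Lsum_smul]
  push_cast
  ring

/-- `‖2‖_p = 1` (odd `p`). [folklore] -/
theorem norm_two_eq_one (S : G3Setup p) : ‖(2 : ℚ_[p])‖ = 1 := PadicExp.norm_two_eq_one S.hp3

/-- **Depth of the new exponent sums**: `‖Lsum(wᵢ) − Lsum(w_{i′})‖ ≤ p^{−(m+1)}` from the slab of the old family. [folklore] -/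
theorem norm_Lsum_halfDiff_sub_le {m : ℕ} {i i' : ι} (hpar : ∀ j, 2 ∣ v i j - v i₀ j) (hpar' : ∀ j, 2 ∣ v i' j - v i₀ j)
    (hslab : ‖S.Lsum (v i) - S.Lsum (v i')‖ ≤ (p : ℝ)⁻¹ ^ (m + 1)) :
    ‖S.Lsum (S.halfDiff v i₀ i) - S.Lsum (S.halfDiff v i₀ i')‖ ≤ (p : ℝ)⁻¹ ^ (m + 1) := by
  have h2 : (2 : ℚ_[p]) * (S.Lsum (S.halfDiff v i₀ i) - S.Lsum (S.halfDiff v i₀ i')) = S.Lsum (v i) - S.Lsum (v i') := by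
    rw [mul_sub, S.two_mul_Lsum_halfDiff v i₀ hpar, S.two_mul_Lsum_halfDiff v i₀ hpar']; ring
  have := congrArg (‖·‖) h2
  simp only [norm_mul, S.norm_two_eq_one, one_mul] at this
  rw [this]; exact hslab

/-- `‖Lsum(wᵢ)‖ ≤ p^{−(m+1)}` (the pivot's `w` is `0`). [folklore] -/
theorem norm_Lsum_halfDiff_le {m : ℕ} {i : ι} (hpar : ∀ j, 2 ∣ v i j - v i₀ j)
    (hslab : ‖S.Lsum (v i) - S.Lsum (v i₀)‖ ≤ (p : ℝ)⁻¹ ^ (m + 1)) :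
    ‖S.Lsum (S.halfDiff v i₀ i)‖ ≤ (p : ℝ)⁻¹ ^ (m + 1) := by
  have h := S.norm_Lsum_halfDiff_sub_le v i₀ hpar (fun j => by simp) hslab (i' := i₀)
  rwa [S.halfDiff_self, show S.Lsum (0 : Fin S.n → ℤ) = 0 by unfold Lsum; simp, sub_zero] at h

/-- **Depth of the new exponents**: `‖E(wᵢ)‖ ≤ p^{−(m+1)}` if also `‖Λ/b_{j₀}‖ ≤ p^{−(m+1)}`. [folklore] -/
theorem norm_E_halfDiff_le {m : ℕ} {i : ι} (hpar : ∀ j, 2 ∣ v i j - v i₀ j)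
    (hslab : ‖S.Lsum (v i) - S.Lsum (v i₀)‖ ≤ (p : ℝ)⁻¹ ^ (m + 1)) (hΛ : ‖S.Λ / (S.b S.j₀ : ℚ_[p])‖ ≤ (p : ℝ)⁻¹ ^ (m + 1)) :
    ‖S.E (S.halfDiff v i₀ i)‖ ≤ (p : ℝ)⁻¹ ^ (m + 1) := by
  have hE : S.E (S.halfDiff v i₀ i) = S.Lsum (S.halfDiff v i₀ i) + -((S.halfDiff v i₀ i S.j₀ : ℚ_[p]) * (S.Λ / (S.b S.j₀ : ℚ_[p]))) := by
    unfold E; ring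
  rw [hE]
  refine (IsUltrametricDist.norm_add_le_max _ _).trans (max_le (S.norm_Lsum_halfDiff_le v i₀ hpar hslab) ?_)
  rw [norm_neg, norm_mul]
  exact (mul_le_of_le_one_left (norm_nonneg _) (Padic.norm_int_le_one _)).trans hΛ

/-! ### The rational parts of the root exponents relative to the pivot -/

/-- **General shift**: if `w = κ + 2w′` (any integer vector `κ`), `|wⱼ| ≤ L_j`, then
`qEhG α (rootExp L w s) = (∏ⱼ αⱼ^{wⱼ′ s}) · ∏ⱼ αⱼ^{L_j|s| + ⌊κⱼ s/2⌋}`. [cite: Yu1990, (2.103); shape only] -/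
theorem qEhG_rootExp_of_shift {L : Fin S.n → ℕ} {w w' κ : Fin S.n → ℤ} (hw : ∀ j, |w j| ≤ (L j : ℤ))
    (hww : w = κ + (2 : ℤ) • w') (s : ℤ) :
    HalfMono.qEhG S.α (S.rootExp L w s) =
      (∏ j, S.α j ^ (w' j * s)) * ∏ j, S.α j ^ ((L j : ℤ) * |s| + κ j * s / 2) := by
  unfold HalfMono.qEhG
  rw [← prod_mul_distrib]
  refine prod_congr rfl fun j _ => ?_
  rw [← zpow_natCast, ← zpow_add₀ (S.α_ne j)]
  congr 1
  have hc := S.rootExp_cast hw s j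
  have hwj : w j = κ j + 2 * w' j := by
    rw [hww]; simp only [Pi.add_apply, Pi.smul_apply, smul_eq_mul]
  generalize hP : (L j : ℤ) * |s| = P at hc ⊢
  have hQ' : w j * s = κ j * s + 2 * (w' j * s) := by rw [hwj]; ring
  rw [hQ'] at hc
  generalize hQ : w' j * s = Q at hc ⊢
  generalize hK : κ j * s = K at hc ⊢
  -- `(e : ℤ) = K + 2Q + 2P`, `⌊e/2⌋ = Q + P + ⌊K/2⌋`
  have h2 : ((S.rootExp L w s j : ℕ) : ℤ) = 2 * (Q + P) + K := by rw [hc]; ring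
  omega

end G3Setup

end Summit.ABC.StewartYu

end
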